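import Literature.Topology.FourManifolds.KirbyMovesSlideAlignRefutation
import HarnessLib

/-!
# Refutation of the retired slide lemma (S₁): the wild band defeats `SlideDiffeoFor`

Topic `Literature/Topology/FourManifolds`. The slide model (S)
`Literature.Topology.FourManifolds.FramedLink.IsStrictHandleSlide.slideModel`
(`KirbyMovesHandleSlide.lean`; R. C. Kirby, *The Topology of 4-Manifolds* (1989), Ch. I §4) was
once split in the tree into a "slide diffeomorphism" statement (S₁) and the algebra of linking
numbers. Per strict slide datum `(L, L', i, j, ν, b)`, (S₁) is the predicate
`Literature.Topology.FourManifolds.FramedLink.IsStrictHandleSlide.SlideDiffeoFor`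
(`KirbyMovesSlideModel.lean`): for every presentation of the surgered manifold `Yⱼ` by a tube
`νⱼ ⊆ ν(S¹ × ℝ²)` of framing `nⱼ`, a diffeomorphism of `Yⱼ` transporting a tube `μᵢ` of `Kᵢ`, whose
push-off misses the band surface `b.support`, to a tube of `Kᵢ'` with the transported framing
(`FramedLink.IsStrictHandleSlide.PushOffTransport`). Its universal closure over all strict slide
data — the former closed named fact (S₁) of `KirbyMovesSlideModel.lean`, retired — is **false**
over the tree's corner-free band data, as recorded in prose in the module docstring of
`KirbyMovesSlideModel.lean` (§ Status, review of the split, 2026-08-15) and proved here. The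
aligned form (S₁ᵃ) (`KirbyMovesSlideAlign.lean`; per datum the predicate
`FramedLink.IsStrictHandleSlide.SlideDiffeoAlignedFor`) was refuted formally in
`KirbyMovesSlideAlignRefutation.lean` (`FramedLink.IsStrictHandleSlide.not_slideDiffeoAligned`,
wild-band counterexample of `WildStrandBand.lean`, degree obstruction of
`CircleHomotopySurjective.lean`). This file runs the same counterexample against (S₁):

* `Literature.Topology.FourManifolds.WildStrand.not_slideDiffeoFor` — **pointwise**: for the
  wild-strand datum built from any tubular neighbourhood `μ` of any knot, with both links framed by
  a framing `m` of the slide tube, `¬ SlideDiffeoFor L L' i j (slideTube μ) (bandData' μ)`;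
* `Literature.Topology.FourManifolds.WildStrand.not_slideDiffeo_of`,
  `Literature.Topology.FourManifolds.FramedLink.IsStrictHandleSlide.not_slideDiffeo` — the
  negation of the universal closure (every universe `u`; index type `ULift (Fin 2)`), i.e. of the
  retired closed statement (S₁) word for word.

(S₁) differs from (S₁ᵃ) in two binders only: it assumes a framing `ν.HasFraming (L.framing j)`
of the slide tube, and it quantifies over *all* presentations of the surgered manifold `Yⱼ` by a
tube `νⱼ ⊆ ν(S¹ × ℝ²)` of framing `L.framing j` instead of the aligned ones. Both are met by the
wild-strand configuration once the framings of the two links are set to a framing `m` of the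
slide tube (`Knot.TubularNbhd.exists_hasFraming`; the links of `WildStrand` with `framing := m`,
same components) and `Yⱼ` is presented by the slide tube itself (`TubeNbhd.surgery_exists_with`,
`TubeSurgery.lean`; `νⱼ = ν`).

**The counterexample** (`WildStrandBand.lean`, in the coordinates of one tubular neighbourhood
`μ` of the unknot `K`): `ι = ULift (Fin 2)`, `L = (Kᵢ, Kⱼ) = (KI μ, K)` with `Kᵢ` the reversed strand
`x ↦ μ (x̄, p)`, `p = (1 + 1/√5, 0)`; the slide tube `ν = slideTube μ = μ.squeeze 1` of `Kⱼ = K`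
(image the open unit tube, off `Kᵢ`), push-off `Kⱼ' = P μ`, the strand at `q = (1/√5, 0)`;
`L' = (K', K)` with `K'` the band sum of `Kᵢ` and `Kⱼ'` along the **wild band** `band μ`
(`BandCore.rebuildData`, `BandCoreRebuild.lean`), a genuine `BandData` avoiding `Kⱼ ∪ ν.collar`
whose support nevertheless contains the punctured meridian disc
`G = {μ (circlePoint (3/5), p + w) | 0 < ‖w‖ < 1/50}` of `Kᵢ` (`WildStrand.mem_support`) — the
tree's `BandData` (`BandSum.lean`) constrains the band only on the *open* collar square, where the
wild band is an honest injective immersion.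

**The obstruction** (`CircleHomotopySurjective.lean`): `SlideDiffeoFor` provides, for that
presentation, `T = ∅` and the thin tube `Vᵢ = μ (S¹ × B(p, 1/50)) ⊇ Kᵢ`, a tubular neighbourhood
`μᵢ ⊆ Vᵢ` of `Kᵢ` with `range μᵢ.pushOff` disjoint from the support of the band. But the push-off
`x ↦ μᵢ (x, e₀)` is homotopic to `Kᵢ` inside `Vᵢ` (radially, `σ ↦ μᵢ (x, σ e₀)`); reading the
homotopy in the coordinates of `μ`, its angular part is a loop of loops in `S¹` starting at the
reversed standard loop, so its final loop is onto
(`exists_apply_eq_of_apply_zero_eq_circlePoint_neg`: degree `-1` loops are not null-homotopic)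
and passes through the angle `3/5`; there the fibre coordinate is within `1/50` of `p` (we are in
`Vᵢ`) and `≠ p` (the push-off misses `Kᵢ`), i.e. the push-off meets `G ⊆ support`. Contradiction.
The obstruction half is the argument of `WildStrand.not_slideDiffeoAligned_of`, verbatim.

Kirby's printed move (Ch. I §4, p. 10, Figs. 4.2–4.4) slides along an embedded *closed* band and
says nothing about push-offs of `Kᵢ` missing a band surface; the vendored closed statement was
wider than the source and false in that width, which is why (S₁) and (S₁ᵃ) were merged back into
(S) (to be proved directly) and (S₁) was retired from the named facts, first as a deprecated
tombstone with this theorem as its `refuted_by` pointer (verdict clean-up of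
`KirbyMovesSlideModel.lean`, third pass) and then by deletion of the closed definition in favour of
the per-datum predicate (fourth pass, 2026-08-16: the statements below are the same propositions
as before, now spelled through `SlideDiffeoFor`). Everything here is proved; no definition and no
named fact is introduced.

## References

* R. C. Kirby, *The Topology of 4-Manifolds*, LNM 1374, Springer (1989), Ch. I §4, §5 Thm. 5.1.
  [cite: Kirby1989, Ch. I §4]
* A. Hatcher, *Algebraic Topology* (2002), §1.1 Thm. 1.7 (degree of circle maps).
  [cite: HatcherAT2002, §1.1 Thm. 1.7]
-/

noncomputable section

open Set Real Filter Function
open scoped Manifold ContDiff Topology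

namespace Literature.Topology.FourManifolds

/-- Local notation: `𝔼 n` is the model Euclidean space `EuclideanSpace ℝ (Fin n)`. -/
local notation "𝔼 " n:arg => EuclideanSpace ℝ (Fin n)

/-- Local notation: `𝕊 n` is the unit sphere in `EuclideanSpace ℝ (Fin (n + 1))`. -/
local notation "𝕊 " n:arg => (Metric.sphere (0 : EuclideanSpace ℝ (Fin (n + 1))) 1)

namespace WildStrand

open WildFlap

variable {K : Knot}

universe u

attribute [local instance] fact_finrank_euclideanSpace_two fact_finrank_euclideanSpace_four

/-- **(S₁) fails at the wild-strand datum** built from any tubular neighbourhood `μ` of any knot: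
with both links framed by a framing `m` of the slide tube `slideTube μ`, the per-datum slide
statement `SlideDiffeoFor L L' i j (slideTube μ) (bandData' μ)` is false — presenting the surgered
manifold by the slide tube itself, the push-off of every tubular neighbourhood of `Kᵢ` inside the
thin tube `μ (S¹ × B(p, 1/50))` meets the punctured meridian disc
`{μ (circlePoint (3/5), p + w) | 0 < ‖w‖ < 1/50} ⊆ support` (degree of the angular part of the
radial homotopy), contradicting the push-off clause of `PushOffTransport`. [folklore] -/
theorem not_slideDiffeoFor (μ : Knot.TubularNbhd K) {m : ℤ} (hm : (slideTube μ).HasFraming m) :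
    ¬ FramedLink.IsStrictHandleSlide.SlideDiffeoFor
        (⟨(linkLU.{u} μ).toLink, fun _ ↦ m⟩ : FramedLink (ULift.{u} (Fin 2)))
        ⟨(linkLU'.{u} μ).toLink, fun _ ↦ m⟩ ⟨0⟩ ⟨1⟩ (slideTube μ) (bandData'.{u} μ) := by
  rintro ⟨U, -, -, hmain⟩
  -- the surgered manifold, presented by the slide tube itself
  obtain ⟨Y, _, _, _, _, _, _, jA, jB, hjA, hjAo, hjB, hjBo, hcov, hrel⟩ :=
    TubeNbhd.surgery_exists_with (slideTube μ).toTubeNbhd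
  -- the thin tube about `Kᵢ`
  set Vᵢ : Set (𝕊 3) := ⇑μ '' (univ ×ˢ Metric.ball pI (1 / 50)) with hVᵢ
  have hVo : IsOpen Vᵢ := μ.isOpenMap _ (isOpen_univ.prod Metric.isOpen_ball)
  have hKV : range ⇑((⟨(linkLU.{u} μ).toLink, fun _ ↦ m⟩ :
      FramedLink (ULift.{u} (Fin 2))).component ⟨0⟩) ⊆ Vᵢ := by
    change range ⇑(KI μ) ⊆ Vᵢ
    rw [range_KI]
    exact image_mono (prod_mono subset_rfl (singleton_subset_iff.2 (Metric.mem_ball_self (by norm_num))))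
  obtain ⟨-, μᵢ, -, hμV, -, -, -, hsupp, -⟩ := hmain (slideTube μ) hm subset_rfl jA jB hjA hjAo hjB
    hjBo hcov hrel ∅ isCompact_empty (empty_subset _) Vᵢ hVo hKV univ isOpen_univ (subset_univ _)
  change Disjoint (range ⇑μᵢ.pushOff) (band μ '' squareNhd (1 / 10)) at hsupp
  -- ### the radial homotopy from `Kᵢ` to the push-off, in the coordinates of `μ`
  have hVμ : Vᵢ ⊆ range ⇑μ := image_subset_range _ _
  set e := μ.isSmoothEmbedding.isEmbedding.toHomeomorph with he
  have he_apply : ∀ z, (e z : 𝕊 3) = μ z := fun z ↦ by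
    rw [he, Topology.IsEmbedding.toHomeomorph_apply_coe]; rfl
  have he_symm : ∀ (z) (h : μ z ∈ range ⇑μ), e.symm ⟨μ z, h⟩ = z := fun z h ↦
    e.injective (by rw [e.apply_symm_apply]; exact Subtype.ext (he_apply z).symm)
  set Hh : ℝ × ℝ → 𝕊 3 := fun p ↦ μᵢ (circlePoint (2 * π * p.1), p.2 • framingBaseVector) with hHh
  have hHc : Continuous Hh := by
    refine μᵢ.continuous.comp ((contMDiff_circlePoint.continuous.comp ?_).prodMk ?_)
    · exact (continuous_const.mul continuous_fst)
    · exact continuous_snd.smul continuous_const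
  have hHmem : ∀ p, Hh p ∈ range ⇑μ := fun p ↦ hVμ (hμV (mem_range_self _))
  set A : ℝ × ℝ → 𝕊 1 := fun p ↦ (e.symm ⟨Hh p, hHmem p⟩).1 with hAdef
  have hAc : Continuous A :=
    continuous_fst.comp (e.symm.continuous.comp (hHc.subtype_mk _))
  -- at time `0` the loop is the reversed standard loop
  have hA0 : ∀ t ∈ Icc (0 : ℝ) 1, A (t, 0) = circlePoint (-(2 * π * t)) := by
    intro t _
    have h1 : Hh (t, 0) = μ (circlePoint (-(2 * π * t)), pI) := by
      simp only [hHh, zero_smul, Knot.TubularNbhd.coe_apply_zero]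
      exact KI_apply_circlePoint μ _
    simp only [hAdef]
    rw [show (⟨Hh (t, 0), hHmem (t, 0)⟩ : range ⇑μ) = ⟨μ (circlePoint (-(2 * π * t)), pI),
      h1 ▸ hHmem (t, 0)⟩ from Subtype.ext h1, he_symm]
  -- each time slice is a loop
  have hAper : ∀ σ ∈ Icc (0 : ℝ) 1, A (0, σ) = A (1, σ) := by
    intro σ _
    have : Hh (0, σ) = Hh (1, σ) := by
      simp only [hHh, mul_zero, mul_one]
      rw [← circlePoint_add_two_pi 0, zero_add]
    simp only [hAdef]
    rw [show (⟨Hh (0, σ), hHmem (0, σ)⟩ : range ⇑μ) = ⟨Hh (1, σ), hHmem (1, σ)⟩ from Subtype.ext this]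
  -- ### hence the final loop passes through the angle `3/5`
  obtain ⟨t, -, ht⟩ := exists_apply_eq_of_apply_zero_eq_circlePoint_neg hAc hA0 hAper
    (circlePoint (3 / 5))
  set z := e.symm ⟨Hh (t, 1), hHmem (t, 1)⟩ with hz
  have hμz : μ z = Hh (t, 1) := by
    have := congrArg Subtype.val (e.apply_symm_apply ⟨Hh (t, 1), hHmem (t, 1)⟩)
    rw [he_apply] at this
    exact this
  have hz1 : z.1 = circlePoint (3 / 5) := ht
  -- the point is on the push-off of `μᵢ`
  have hpush : Hh (t, 1) ∈ range ⇑μᵢ.pushOff := ⟨circlePoint (2 * π * t), by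
    rw [Knot.TubularNbhd.pushOff_apply, hHh]; simp⟩
  -- its fibre coordinate is within `1/50` of `p` ...
  have hW : ‖z.2 - pI‖ < 1 / 50 := by
    have hV : μ z ∈ Vᵢ := hμz ▸ hμV (mem_range_self _)
    obtain ⟨⟨x, w⟩, ⟨-, hw⟩, hxw⟩ := hV
    have := μ.injective hxw
    rw [← this]
    simpa [dist_eq_norm] using hw
  -- ... and different from `p` (the push-off misses `Kᵢ`)
  have hW0 : z.2 - pI ≠ 0 := by
    intro h0
    have hzK : μ z ∈ range ⇑(KI μ) := by
      rw [range_KI, show z = (z.1, z.2) from rfl, sub_eq_zero.1 h0]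
      exact (apply_mem_image_singleton_iff μ).2 rfl
    exact Set.disjoint_left.1 μᵢ.disjoint_range_pushOff hzK (hμz ▸ hpush)
  -- so it lies on the punctured meridian disc inside the support: contradiction
  have hmem := mem_support μ hW0 hW
  rw [← hz1, add_sub_cancel, show ((z.1, z.2) : (𝕊 1) × 𝔼 2) = z from rfl, hμz] at hmem
  exact Set.disjoint_left.1 hsupp hpush hmem

/-- **The universal closure of `SlideDiffeoFor` is false** — the retired closed statement (S₁),
word for word — for the configuration built from any tubular neighbourhood `μ` of any knot: frame
both links by a framing of the slide tube (`Knot.TubularNbhd.exists_hasFraming`) and specialise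
the closure to the wild-strand datum (`not_slideDiffeoFor`). [folklore] -/
theorem not_slideDiffeo_of (μ : Knot.TubularNbhd K) :
    ¬ ∀ {ι : Type u} [Finite ι] {L L' : FramedLink ι} {i j : ι} (_hij : i ≠ j)
        (ν : Knot.TubularNbhd (L.component j))
        (b : BandData (L.component i) ν.pushOff (L'.component i)
          ((⋃ k ∈ {k | k ≠ i}, range ⇑(L.component k)) ∪ ν.collar))
        (_hrest : ∀ k, k ≠ i → L'.component k = L.component k)
        (_hfr : ν.HasFraming (L.framing j))
        (_hdisj : ∀ k, k ≠ j → Disjoint (range ⇑ν) (range ⇑(L.component k))),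
        FramedLink.IsStrictHandleSlide.SlideDiffeoFor L L' i j ν b := by
  intro hS
  -- a framing of the slide tube, copied into the framings of both links
  obtain ⟨m, hm⟩ := (slideTube μ).exists_hasFraming
  have h01 : (⟨0⟩ : ULift.{u} (Fin 2)) ≠ ⟨1⟩ := fun h ↦ by cases h
  have hrest : ∀ k : ULift.{u} (Fin 2), k ≠ ⟨0⟩ →
      (⟨(linkLU'.{u} μ).toLink, fun _ ↦ m⟩ : FramedLink (ULift.{u} (Fin 2))).component k =
        (⟨(linkLU.{u} μ).toLink, fun _ ↦ m⟩ : FramedLink (ULift.{u} (Fin 2))).component k := by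
    rintro ⟨k⟩ hk
    fin_cases k
    · exact absurd rfl hk
    · rfl
  have hdisj : ∀ k : ULift.{u} (Fin 2), k ≠ ⟨1⟩ → Disjoint (range ⇑(slideTube μ))
      (range ⇑((⟨(linkLU.{u} μ).toLink, fun _ ↦ m⟩ : FramedLink (ULift.{u} (Fin 2))).component k)) := by
    rintro ⟨k⟩ hk
    fin_cases k
    · exact disjoint_range_slideTube_range_KI μ
    · exact absurd rfl hk
  exact not_slideDiffeoFor μ hm (@hS (ULift.{u} (Fin 2)) _ ⟨(linkLU.{u} μ).toLink, fun _ ↦ m⟩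
    ⟨(linkLU'.{u} μ).toLink, fun _ ↦ m⟩ ⟨0⟩ ⟨1⟩ h01 (slideTube μ) (bandData'.{u} μ) hrest hm hdisj)

end WildStrand

/-- **Refutation of (S₁).** The universal closure, over all strict slide data, of the per-datum
slide statement `FramedLink.IsStrictHandleSlide.SlideDiffeoFor` (`KirbyMovesSlideModel.lean`) —
the tree's former "slide diffeomorphism" split (S₁) of the slide model (S) for R. C. Kirby, *The
Topology of 4-Manifolds* (1989), Ch. I §4, once a closed named fact and retired as refuted — is
false: instantiate the wild-strand configuration of `WildStrandBand.lean` at a tubular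
neighbourhood of the unknot, with the links framed by a framing of the slide tube and the surgered
manifold presented by the slide tube (`WildStrand.not_slideDiffeo_of`, `WildStrand.not_slideDiffeoFor`).
The printed move slides along an embedded closed band; the tree's `BandData` only constrains the
open collar square, and the push-off clause of `PushOffTransport` then fails for the wild band.
[cite: Kirby1989, Ch. I §4] -/
theorem FramedLink.IsStrictHandleSlide.not_slideDiffeo.{u} :
    ¬ ∀ {ι : Type u} [Finite ι] {L L' : FramedLink ι} {i j : ι} (_hij : i ≠ j)
        (ν : Knot.TubularNbhd (L.component j))
        (b : BandData (L.component i) ν.pushOff (L'.component i)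
          ((⋃ k ∈ {k | k ≠ i}, range ⇑(L.component k)) ∪ ν.collar))
        (_hrest : ∀ k, k ≠ i → L'.component k = L.component k)
        (_hfr : ν.HasFraming (L.framing j))
        (_hdisj : ∀ k, k ≠ j → Disjoint (range ⇑ν) (range ⇑(L.component k))),
        FramedLink.IsStrictHandleSlide.SlideDiffeoFor L L' i j ν b := fun hS ↦ by
  obtain ⟨μ⟩ := Knot.nonempty_tubularNbhd_holds unknot
  exact WildStrand.not_slideDiffeo_of.{u} μ hS

end Literature.Topology.FourManifolds
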